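import Literature.Analysis.FluidPDE.BarkerPrangeConcentrationHolds
import Literature.Analysis.FluidPDE.NSCriticalClosureBesovKatoClass
import Literature.Analysis.FluidPDE.NSCriticalClosureBesovBounded
import Literature.Analysis.FluidPDE.NSLerayExistenceR3Holds
import Literature.Analysis.FluidPDE.NSWeakStrongUniquenessHolds
import Literature.Analysis.FluidPDE.KatoMaximalTimeSingular
import Literature.Analysis.FluidPDE.TaoLocalisationHolds

/-!
# Route TypeICertificateLadder — crux `TypeIConcentration` (item stmt-NavierStokesRegularity-2881):
# Barker–Prange concentration packaged for classical Leray–Hopf solutions (uniform constants)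

The route decl `TypeICertificateLadder.TypeIConcentration` asks, at a Type-I(`C`) blow-up of a
classical Leray–Hopf solution from a rapidly decaying datum, for a point `x₀` with
`γ ν³ ≤ ∫_{B(x₀, ρ√(ν(T-t)))} |u(t)|³` for all `t` near `T`, with `ρ, γ` depending on `C` only.
The printed engine is Barker–Prange 2020, Thm. 2 (arXiv:1812.09115, pp. 4–5), PROVED in the tree
(`BarkerPrange2020_thm2_holds`), which needs the Morrey-type Type-I bound
`‖u(t)‖_{L²(B_r(x̄))} ≤ M ν √r` (their (1.7)) and then gives the radius `2√(ν(T-t)/S*(M))` and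
the universal threshold `γ_univ ν`.

This helper file (it does not close the item) proves the CLAY-CLASS PACKAGING of that theorem with
constants UNIFORM in the solution:

* `bp_concentration_of_morrey` — there is `γ > 0` and for every `M > 0` a radius `ρ = ρ(M) > 0`
  such that every classical solution of the unforced system on `ℝ³ × [0, T)`, Leray–Hopf from
  its rapidly decaying datum, which does NOT extend smoothly past `T` and satisfies, eventually as
  `t ↑ T`, the Morrey bound `∫_{B_r(y)} |u(t)|² ≤ M² ν² r` for all centres `y` and radii
  `0 < r ≤ r₁` (some `r₁ > 0`), has a point `x₀` with
  `γ ν³ ≤ ∫_{B(x₀, ρ √(ν(T-t)))} |u(t)|³` for all `t` near `T`.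

All the bookkeeping between the Clay class and the hypotheses of the Literature fact is discharged
by theorems of the tree: Leray's global weak continuation (`leray_existence_R3_holds`) agrees with
`u` on `(0, T)` by weak–strong uniqueness (`weak_strong_uniqueness_holds`, the classical solution
being bounded on closed sub-strips, `exists_forall_norm_le_of_tao2011`), so it is regular on the
open strip and inherits the Morrey bound; `¬ HasSmoothExtensionPast` yields a singular point
`(T, x₀)` in the backward-cylinder sense (Lemarié-Rieusset 2016, Thm. 15.1 (C):
`exists_singularPoint_of_classical_of_not_hasSmoothExtensionPast`), transferred to the continuation
along the a.e. equality; finally the `L³(closed ball)` lower bound is cubed into the Bochner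
integral over the open ball (null sphere). With the route's support item `ScaledEnergyBound`
(stmt-…-2884: `M = M(C)`) this gives `TypeIConcentration` (sibling file).
-/

noncomputable section

namespace Summit.NavierStokesRegularity.NavierStokesRegularity.Theorems

open MeasureTheory Set Function Filter Topology TopologicalSpace Metric
open Literature.Analysis.FluidPDE
open scoped NNReal ENNReal

/-- Closed and open balls of `ℝ³` agree up to a Lebesgue-null set (the sphere is null). [folklore] -/
theorem typeIConc_closedBall_ae_eq_ball (x : EuclideanSpace ℝ (Fin 3)) (r : ℝ) :
    (closedBall x r : Set (EuclideanSpace ℝ (Fin 3))) =ᵐ[volume] ball x r := by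
  refine (ae_eq_set).2 ⟨?_, ?_⟩
  · rw [closedBall_sdiff_ball]
    exact Measure.addHaar_sphere volume x r
  · rw [sdiff_eq_empty.2 ball_subset_closedBall, measure_empty]

/-- For a continuous field, `∫⁻_{B} ‖f‖ₑ^n = ofReal (∫_{B} ‖f‖^n)` on a ball (the power of the
norm is integrable on the bounded ball). [folklore] -/
theorem typeIConc_lintegral_ball_enorm_pow_eq {f : EuclideanSpace ℝ (Fin 3) → EuclideanSpace ℝ (Fin 3)}
    (hf : Continuous f) (x : EuclideanSpace ℝ (Fin 3)) (r : ℝ) (n : ℕ) :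
    ∫⁻ y in ball x r, ‖f y‖ₑ ^ n = ENNReal.ofReal (∫ y in ball x r, ‖f y‖ ^ n) := by
  have hint : IntegrableOn (fun y => ‖f y‖ ^ n) (ball x r) volume := by
    have hc : Continuous fun y => ‖f y‖ ^ n := (continuous_norm.comp hf).pow n
    exact (hc.continuousOn.integrableOn_compact (isCompact_closedBall x r)).mono_set
      ball_subset_closedBall
  rw [ofReal_integral_eq_lintegral_ofReal hint (Eventually.of_forall fun y => by positivity)]
  refine lintegral_congr fun y => ?_
  rw [← ofReal_norm, ENNReal.ofReal_pow (norm_nonneg _)]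

/-- **Barker–Prange concentration for Clay-class solutions, constants uniform in the solution.**
There is `γ > 0` (the cube of Barker–Prange's universal `γ_univ`) and for every `M > 0` a radius
`ρ = 2/√(S*(M)) > 0` such that: for `ν > 0`, `T > 0`, a classical solution `(u, p)` of the
unforced Navier–Stokes system on `ℝ³ × [0, T)` which is Leray–Hopf from its rapidly decaying
datum, satisfies eventually as `t ↑ T` the Morrey-type bound `∫_{B_r(y)} ‖u(t)‖² ≤ M² ν² r` for
all `y` and all `0 < r ≤ r₁` (some `r₁ > 0`), and does not extend smoothly past `T`, there is a
point `x₀` with `γ ν³ ≤ ∫_{B(x₀, ρ√(ν(T-t)))} ‖u(t)‖³` for all `t < T` close to `T`. Proof: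
Barker–Prange 2020 Thm. 2 (`BarkerPrange2020_thm2_holds`) applied to Leray's global weak
continuation of `u` (`leray_existence_R3_holds`), which coincides with `u` a.e. at every time of
`(0, T)` (`weak_strong_uniqueness_holds`; `u` is bounded on closed sub-strips,
`exists_forall_norm_le_of_tao2011`), hence is regular on the open strip and satisfies the Morrey
bound there, with `r₀ = min(r₁, √(ν(T - t₁)))/2` so that the admissible times lie in the eventual
range; the singular point comes from `exists_singularPoint_of_classical_of_not_hasSmoothExtensionPast`
(Lemarié-Rieusset 2016, Thm. 15.1 (C)) and is transferred along the a.e. equality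
(`eLpNorm_parabolicCylinder_eq_top_of_ae_eq`); the conclusion `γ_univ ν < ‖u(t)‖_{L³(closed ball)}`
is cubed (null sphere, continuous slice). [cite: BarkerPrange2020, Thm. 2 (arXiv:1812.09115 pp. 4–5); LemarieRieusset2016, Thm. 15.1 (C)] -/
theorem bp_concentration_of_morrey :
    ∃ γ : ℝ, 0 < γ ∧ ∀ M : ℝ, 0 < M → ∃ ρ : ℝ, 0 < ρ ∧
      ∀ (ν T : ℝ), 0 < ν → 0 < T →
        ∀ (u : ℝ → EuclideanSpace ℝ (Fin 3) → EuclideanSpace ℝ (Fin 3))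
          (p : ℝ → EuclideanSpace ℝ (Fin 3) → ℝ),
          IsClassicalNSSolutionOn (Ico 0 T) ν 0 u p → IsLerayHopfOn T ν 0 (u 0) u →
          HasRapidSpatialDecay (u 0) →
          (∃ r₁ : ℝ, 0 < r₁ ∧ ∀ᶠ t in 𝓝[<] T, ∀ (y : EuclideanSpace ℝ (Fin 3)) (r : ℝ),
              0 < r → r ≤ r₁ → ∫ x in ball y r, ‖u t x‖ ^ 2 ≤ M ^ 2 * ν ^ 2 * r) →
          ¬ HasSmoothExtensionPast ν 0 u T →
          ∃ x₀ : EuclideanSpace ℝ (Fin 3), ∀ᶠ t in 𝓝[<] T,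
            γ * ν ^ 3 ≤ ∫ x in ball x₀ (ρ * Real.sqrt (ν * (T - t))), ‖u t x‖ ^ 3 := by
  obtain ⟨γ₀, hγ₀, hBP⟩ := BarkerPrange2020_thm2_holds
  refine ⟨γ₀ ^ 3, by positivity, fun M hM => ?_⟩
  obtain ⟨S, hS, -, hBPM⟩ := hBP M hM
  refine ⟨2 / Real.sqrt S, by positivity, ?_⟩
  intro ν T hν hT u p hcl hLH hdec hmor hnext
  obtain ⟨r₁, hr₁, hmor⟩ := hmor
  -- a singular point `(T, x₀)` of `u`
  obtain ⟨x₀, hx₀⟩ := exists_singularPoint_of_classical_of_not_hasSmoothExtensionPast hν hT hcl hLH hdec hnext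
  refine ⟨x₀, ?_⟩
  -- the eventual range `(t₁, T)` of the Morrey bound, `0 ≤ t₁`
  obtain ⟨t₁', ht₁'T, ht₁'⟩ := mem_nhdsLT_iff_exists_Ioo_subset.1 hmor
  set t₁ : ℝ := max t₁' 0 with ht₁def
  have ht₁T : t₁ < T := max_lt ht₁'T hT
  have ht₁0 : 0 ≤ t₁ := le_max_right _ _
  have hmorr : ∀ t ∈ Ioo t₁ T, ∀ (y : EuclideanSpace ℝ (Fin 3)) (r : ℝ), 0 < r → r ≤ r₁ →
      ∫ x in ball y r, ‖u t x‖ ^ 2 ≤ M ^ 2 * ν ^ 2 * r := fun t ht =>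
    ht₁' ⟨lt_of_le_of_lt (le_max_left _ _) ht.1, ht.2⟩
  -- the radius bound `r₀` of Barker–Prange
  set r₀ : ℝ := min r₁ (Real.sqrt (ν * (T - t₁))) / 2 with hr₀def
  have hνT : 0 < ν * (T - t₁) := mul_pos hν (sub_pos.2 ht₁T)
  have hr₀pos : 0 < r₀ := by
    have : 0 < min r₁ (Real.sqrt (ν * (T - t₁))) := lt_min hr₁ (Real.sqrt_pos.2 hνT)
    rw [hr₀def]; linarith
  have hr₀r₁ : r₀ < r₁ := by
    have h1 : min r₁ (Real.sqrt (ν * (T - t₁))) ≤ r₁ := min_le_left _ _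
    rw [hr₀def]; linarith
  have hr₀sq : r₀ ^ 2 < ν * (T - t₁) := by
    have h1 : min r₁ (Real.sqrt (ν * (T - t₁))) ≤ Real.sqrt (ν * (T - t₁)) := min_le_right _ _
    have h2 : r₀ < Real.sqrt (ν * (T - t₁)) := by
      have h3 : 0 < Real.sqrt (ν * (T - t₁)) := Real.sqrt_pos.2 hνT
      rw [hr₀def]; linarith
    calc r₀ ^ 2 < Real.sqrt (ν * (T - t₁)) ^ 2 := pow_lt_pow_left₀ h2 hr₀pos.le (by norm_num)
      _ = ν * (T - t₁) := Real.sq_sqrt hνT.le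
  obtain ⟨tStar, -, htStarT, -, hmain⟩ :=
    hBPM ν T hν hT (ENNReal.ofReal r₀) (ENNReal.ofReal_pos.2 hr₀pos)
  -- Leray's global weak continuation `v` of `u`
  have hu02 : MemLp (u 0) 2 volume := hLH.memLp 0 ⟨le_rfl, hT.le⟩
  obtain ⟨v, hv⟩ := leray_existence_R3_holds ν hν (u 0) hu02 (hLH.isWeaklyDivFree_datum hT)
  -- `v(t) = u(t)` a.e. for `0 < t < T`
  have hvu : ∀ t ∈ Ioo 0 T, v t =ᵐ[volume] u t := by
    intro t ht
    set T' : ℝ := (t + T) / 2 with hT'def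
    have htT' : t < T' := by rw [hT'def]; linarith [ht.2]
    have hT'T : T' < T := by rw [hT'def]; linarith [ht.2]
    have hT'0 : 0 < T' := ht.1.trans htT'
    obtain ⟨B, hB⟩ := exists_forall_norm_le_of_tao2011 tao2011_hasBoundedSobolevNormsOn_holds hν
      hcl hLH hdec T' ⟨hT'0, hT'T⟩
    have hSer : MemLqLp ∞ ∞ u (Ioo 0 T') :=
      memLqLp_top_top_of_bound (fun s hs =>
        (hcl.contDiff_velocity ⟨hs.1, hs.2.trans_lt hT'T⟩).continuous.aestronglyMeasurable) hB
    exact weak_strong_uniqueness_holds hν hT'0 (hLH.of_le hT'T.le) (q := ⊤) (r := ⊤)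
      ENNReal.ofNat_lt_top (by simp [ENNReal.div_top]) hSer (hv.isLerayHopfOn hT'0) t
      ⟨ht.1, htT'.le⟩
  -- measurability of `u` on the strip and the product a.e. equality
  have hum : AEStronglyMeasurable (uncurry u) (volume.restrict (Ioo 0 T ×ˢ univ)) :=
    (hcl.smooth_velocity.continuousOn.mono
      (prod_mono Ioo_subset_Ico_self Subset.rfl)).aestronglyMeasurable
      (measurableSet_Ioo.prod MeasurableSet.univ)
  have hvu_ae : uncurry v =ᵐ[volume.restrict (Ioo 0 T ×ˢ (univ : Set (EuclideanSpace ℝ (Fin 3))))]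
      uncurry u :=
    ae_restrict_prod_of_forall_ae_eq hvu (hv T hT).weak.1 hum
  -- (1.7): the Morrey-type bound for `v`
  have hMorrey : ∀ (y : EuclideanSpace ℝ (Fin 3)) (r : ℝ), 0 < r → ENNReal.ofReal r < ENNReal.ofReal r₀ →
      ∀ t : ℝ, 0 < t → T - r ^ 2 / ν < t → t < T →
        eLpNorm (v t) 2 (volume.restrict (ball y r)) ≤ ENNReal.ofReal (M * ν * Real.sqrt r) := by
    intro y r hr hrr₀ t ht0 htr htT
    have hrr₀' : r < r₀ := (ENNReal.ofReal_lt_ofReal_iff hr₀pos).1 hrr₀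
    have hrr₁ : r ≤ r₁ := (hrr₀'.trans hr₀r₁).le
    have hr2 : r ^ 2 < ν * (T - t₁) :=
      lt_of_le_of_lt (pow_le_pow_left₀ hr.le hrr₀'.le 2) hr₀sq
    have ht₁t : t₁ < t := by
      have h1 : r ^ 2 / ν < T - t₁ := by rw [div_lt_iff₀ hν]; linarith
      linarith
    have hbd := hmorr t ⟨ht₁t, htT⟩ y r hr hrr₁
    have hcont : Continuous (u t) := (hcl.contDiff_velocity ⟨ht0.le, htT⟩).continuous
    have hae : v t =ᵐ[volume.restrict (ball y r)] u t := ae_restrict_of_ae (hvu t ⟨ht0, htT⟩)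
    rw [eLpNorm_congr_ae hae, eLpNorm_eq_lintegral_rpow_enorm_toReal (by norm_num) (by norm_num),
      ENNReal.toReal_ofNat]
    have e2 : ∀ x, ‖u t x‖ₑ ^ (2 : ℝ) = ‖u t x‖ₑ ^ (2 : ℕ) := fun x => by
      rw [show (2 : ℝ) = ((2 : ℕ) : ℝ) by norm_num, ENNReal.rpow_natCast]
    simp only [e2]
    rw [typeIConc_lintegral_ball_enorm_pow_eq hcont y r 2]
    have hle : ENNReal.ofReal (∫ x in ball y r, ‖u t x‖ ^ 2) ≤ ENNReal.ofReal ((M * ν * Real.sqrt r) ^ 2) := by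
      refine ENNReal.ofReal_le_ofReal (hbd.trans_eq ?_)
      rw [mul_pow, mul_pow, Real.sq_sqrt hr.le]
    calc (ENNReal.ofReal (∫ x in ball y r, ‖u t x‖ ^ 2)) ^ (1 / (2 : ℝ))
        ≤ (ENNReal.ofReal ((M * ν * Real.sqrt r) ^ 2)) ^ (1 / (2 : ℝ)) := by gcongr
      _ = ENNReal.ofReal (M * ν * Real.sqrt r) := by
          rw [ENNReal.ofReal_rpow_of_nonneg (by positivity) (by norm_num), ← Real.sqrt_eq_rpow,
            Real.sqrt_sq (by positivity)]
  -- every point of the open strip is regular for `v`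
  have hReg : ∀ t ∈ Ioo 0 T, ∀ x : EuclideanSpace ℝ (Fin 3), IsRegularPoint v (t, x) := by
    intro t ht x
    set r : ℝ := Real.sqrt (min t (T - t)) / 2 with hrdef
    have hmin : 0 < min t (T - t) := lt_min ht.1 (sub_pos.2 ht.2)
    have hr : 0 < r := by rw [hrdef]; positivity
    have hr2 : r ^ 2 < min t (T - t) := by
      have h1 : r ^ 2 = min t (T - t) / 4 := by
        rw [hrdef, div_pow, Real.sq_sqrt hmin.le]; norm_num
      rw [h1]; linarith
    have hr2t : r ^ 2 < t := lt_of_lt_of_le hr2 (min_le_left _ _)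
    have hr2T : t + r ^ 2 < T := by
      have := lt_of_lt_of_le hr2 (min_le_right _ _); linarith
    -- the closed box around the cylinder is compact inside `[0, T) × ℝ³`
    set K : Set (ℝ × EuclideanSpace ℝ (Fin 3)) := Icc (t - r ^ 2) (t + r ^ 2) ×ˢ closedBall x r with hKdef
    have hK : IsCompact K := isCompact_Icc.prod (isCompact_closedBall _ _)
    have hKsub : K ⊆ Ico 0 T ×ˢ (univ : Set (EuclideanSpace ℝ (Fin 3))) :=
      prod_mono (fun s hs => ⟨by linarith [hs.1], lt_of_le_of_lt hs.2 hr2T⟩) (subset_univ _)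
    have hcont : ContinuousOn (uncurry u) K := hcl.smooth_velocity.continuousOn.mono hKsub
    obtain ⟨B, hB⟩ := hK.exists_bound_of_continuousOn hcont
    have hcylK : parabolicCylinderCentered r ((t : ℝ), x) ⊆ K := by
      rintro ⟨s, y⟩ hz
      rw [mem_parabolicCylinderCentered] at hz
      exact ⟨⟨hz.1.1.le, hz.1.2.le⟩, mem_closedBall.2 hz.2.le⟩
    have hcylstrip : parabolicCylinderCentered r ((t : ℝ), x) ⊆ Ioo 0 T ×ˢ (univ : Set (EuclideanSpace ℝ (Fin 3))) := by
      rintro ⟨s, y⟩ hz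
      rw [mem_parabolicCylinderCentered] at hz
      exact ⟨⟨by linarith [hz.1.1], by linarith [hz.1.2]⟩, mem_univ _⟩
    refine ⟨r, hr, ?_⟩
    rw [eLpNorm_exponent_top]
    refine eLpNormEssSup_lt_top_of_ae_bound (C := B) ?_
    have h1 : uncurry v =ᵐ[volume.restrict (parabolicCylinderCentered r ((t : ℝ), x))] uncurry u :=
      ae_restrict_of_ae_restrict_of_subset hcylstrip hvu_ae
    filter_upwards [h1, ae_restrict_mem (isOpen_parabolicCylinderCentered r ((t : ℝ), x)).measurableSet]
      with z hz hzmem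
    rw [hz]
    exact hB z (hcylK hzmem)
  -- `(T, x₀)` is a singular point of `v`
  have hSing : ∀ r : ℝ, 0 < r → r ^ 2 < T →
      eLpNorm (uncurry v) ∞ (volume.restrict (parabolicCylinder r ((T : ℝ), x₀))) = ∞ := by
    intro r hr _
    exact eLpNorm_parabolicCylinder_eq_top_of_ae_eq hT hvu_ae x₀
      (fun r' hr' => eLpNorm_top_parabolicCylinder_eq_top_of_small hT hx₀ hr') hr
  -- Barker–Prange, Thm. 2
  have hconc := hmain (u 0) v hv hMorrey hReg x₀ hSing
  -- conclusion, for `max(t_*, 0) < t < T`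
  have hev : Ioo (max tStar 0) T ∈ 𝓝[<] T := Ioo_mem_nhdsLT (max_lt htStarT hT)
  filter_upwards [hev] with t ht
  have ht0 : 0 < t := lt_of_le_of_lt (le_max_right _ _) ht.1
  have htS : tStar < t := lt_of_le_of_lt (le_max_left _ _) ht.1
  have h1 := hconc t ⟨htS, ht.2⟩
  have hcont : Continuous (u t) := (hcl.contDiff_velocity ⟨ht0.le, ht.2⟩).continuous
  -- the radius
  have hrad : 2 * Real.sqrt (ν * (T - t) / S) = 2 / Real.sqrt S * Real.sqrt (ν * (T - t)) := by
    rw [Real.sqrt_div' _ hS.le]; ring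
  set R : ℝ := 2 / Real.sqrt S * Real.sqrt (ν * (T - t)) with hRdef
  rw [hrad] at h1
  -- pass from `v` on the closed ball to `u` on the open ball
  have hae : v t =ᵐ[volume.restrict (closedBall x₀ R)] u t := ae_restrict_of_ae (hvu t ⟨ht0, ht.2⟩)
  rw [eLpNorm_congr_ae hae, Measure.restrict_congr_set (typeIConc_closedBall_ae_eq_ball x₀ R),
    eLpNorm_eq_lintegral_rpow_enorm_toReal (by norm_num) (by norm_num), ENNReal.toReal_ofNat] at h1
  have e3 : ∀ x, ‖u t x‖ₑ ^ (3 : ℝ) = ‖u t x‖ₑ ^ (3 : ℕ) := fun x => by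
    rw [show (3 : ℝ) = ((3 : ℕ) : ℝ) by norm_num, ENNReal.rpow_natCast]
  simp only [e3] at h1
  rw [typeIConc_lintegral_ball_enorm_pow_eq hcont x₀ R 3] at h1
  -- cube both sides
  have h2 : ENNReal.ofReal (γ₀ * ν) ^ (3 : ℝ) <
      ((ENNReal.ofReal (∫ x in ball x₀ R, ‖u t x‖ ^ 3)) ^ (1 / (3 : ℝ))) ^ (3 : ℝ) :=
    ENNReal.rpow_lt_rpow h1 (by norm_num)
  rw [← ENNReal.rpow_mul, one_div, inv_mul_cancel₀ (by norm_num : (3 : ℝ) ≠ 0), ENNReal.rpow_one,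
    ENNReal.ofReal_rpow_of_nonneg (by positivity) (by norm_num)] at h2
  have h3 := (ENNReal.ofReal_lt_ofReal_iff_of_nonneg (by positivity)).1 h2
  have h4 : (γ₀ * ν) ^ (3 : ℝ) = γ₀ ^ 3 * ν ^ 3 := by
    rw [show (3 : ℝ) = ((3 : ℕ) : ℝ) by norm_num, Real.rpow_natCast, mul_pow]
  rw [h4] at h3
  exact h3.le

end Summit.NavierStokesRegularity.NavierStokesRegularity.Theorems

end
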